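import Summits.HodgeConjecture.HodgeConjecture.Theorems.Ring2WeilCoverageRamifiedTypes
import Summits.HodgeConjecture.HodgeConjecture.Theorems.Ring2WeilCoverageRamifiedPrimePowers
import Summits.HodgeConjecture.HodgeConjecture.Theorems.Ring2WeilCoverageCyclotomicSignaturesG6
import Summits.HodgeConjecture.HodgeConjecture.Theorems.Ring2WeilCoverageCyclotomicUnconditional
import HarnessLib

/-!
# Weil-type family coverage — RAMIFIED TYPES AT LEVEL `36` (`g = 6`): every `ℚ(√−3)`-balanced CM type of `ℚ(ζ₃₆)` — the
# census's NO row `(36, √−3)`, the class of the Fermat sixfold `A₃₆` — carries a polarisation of type `𝔮₃` (`𝔮₃⁶ = (3)`,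
# degree `3`, elementary divisors `(1,1,1,1,1,3)`) AND one of type `𝔮₂` (`𝔮₂² = (2)`, degree `8`, `(1,1,1,2,2,2)`); the
# `ℚ(i)`-balanced types carry neither; dichotomies for all `2⁶` CM types

research route conditional on HC_CM; not a corollary; Q11.4-sentence-2 already refuted in dim ≥ 3.

Ring 2, WEIL-TYPE FAMILY-COVERAGE CENSUS (`HOME/WEIL-FAMILY-COVERAGE.md` `## b01`, blocks b01.17 (`A₃₆ = A_[1,8,27]` on `R1 =
(3, ℚ(√−3), 2)` with type `(1,1,1,2,2,2)` and on the SPLIT row with `(1⁵,3)` — t-2 THEOREM PP / this seat's ×2, by exact period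
computations), b01.34 (the NO row `(36, √−3)`), b01.36 (THEOREM L (ii) at 36); owner ring2-b01), part 49b of the
`Ring2WeilCoverage*` series — the KERNEL form of those two polarisation types, for EVERY `ℚ(√−3)`-balanced CM type at once
(parts 48 / 48c):

* type A, `π = ζ³³(1 − ζ⁴)(1 − ζ²)` (`ζ⁴` a primitive 9th root: `(π) = (1 − ζ⁴) = 𝔭₃`, `(π)⁶ = (3)`, `N(𝔬𝔣₀) = 9`, degree `3`):
  `twistSet_thirtySixA` (`X_π = {5, 13, 19, 25, 29, 35}`), `map_type_pow_thirtySixA`, **`exists_type_thirtySixA_sqrt_neg_three`**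
  / **`exists_ramifiedType_thirtySixA_sqrt_neg_three`**, `not_exists_type_thirtySixA_sqrt_neg_one`,
  **`exists_principal_xor_type_thirtySixA`**;
* type B, `π = ζ³¹(1 − ζ⁹)(1 − ζ)` (`ζ⁹ = i`: `(π) = (1 − i) = 𝔭₂`, `(π)² = (2)`, `N(𝔬𝔣₀) = 64`, degree `8`):
  `twistSet_thirtySixB` (`X_π = {7, 11, 13, 17, 31, 35}`), `map_type_pow_thirtySixB`, **`exists_type_thirtySixB_sqrt_neg_three`**
  / **`exists_ramifiedType_thirtySixB_sqrt_neg_three`**, `not_exists_type_thirtySixB_sqrt_neg_one`,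
  **`exists_principal_xor_type_thirtySixB`**.

Both ramified primes of `ℚ(ζ₃₆)⁺` (over `2` and over `3`) are inert in `ℚ(ζ₃₆)` and flip the principal verdict
(`|A_π|/2 = 3` both times); so the `(36, √−3)` classes, with no principal polarisation on `ℤ[ζ₃₆]`, carry BOTH non-principal
types — matching b01.17's table for `A₃₆` line by line.

HONEST FRAMING: torus-level statements about Shimura's divisors `X_ζ′` of type `(K; Φ; 𝔣₀)` on the principal CM torus
`ℂ^Φ/Φ(ℤ[ζ_M])` [Sh98 §14.3 Prop. 4–5] and elementary ideal arithmetic in `ℤ[ζ_M]`; all residue sets are displayed and checked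
by `decide`; WHICH component of the Weil-type locus (split or not) carries the polarised point is NOT decided here — its
hermitian discriminant class is `N_{K⁺/ℚ}(𝔣₀)` times the type-independent determinant class of the torus' trace form modulo
`Nm(K^×)`, split for some types and non-split for others (b01.17, exact periods: `A₃₆`'s degree-3 type lies on the split
`ℚ(√−3)` row, its degree-8 type on `R1 = (3, ℚ(√−3), 2)`); nothing here is a statement about Hodge classes,
`W_K`, general members or HC; `HC_CM` is used nowhere.  No `def`, no named fact, no `sorry`.

References: [cite: Shimura1998, §14.3 Prop. 4–5, pp. 103–104]; [cite: Washington1997, §8.1, Lemma 1.4, Prop. 2.8]; census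
b01.17 / b01.34–b01.38 (seat-derived).
-/

noncomputable section

open Polynomial NumberField Complex Finset
open scoped Real nonZeroDivisors

namespace Summit.HodgeConjecture.Ring2WeilCoverage.RamifiedTypesLevel36

open Literature.AlgebraicGeometry.Motives (CMType)
open Literature.AlgebraicGeometry.HodgeTheory (IsCMTypeSet)
open Literature.AlgebraicGeometry.ComplexMultiplication.CyclotomicCMType (isCMTypeSet_residueFilter)
open Literature.NumberTheory.ComplexMultiplication
open Summit.HodgeConjecture.Ring2WeilCoverage.RamifiedTypes
open Summit.HodgeConjecture.Ring2WeilCoverage.RamifiedPrimePowers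
open Summit.HodgeConjecture.Ring2WeilCoverage.CyclotomicUnitProducts (isUnit_one_sub_toInteger_pow)
open Summit.HodgeConjecture.Ring2WeilCoverage.CMTypeSetPairCount (card_inter_add_card_inter_eq)
open Summit.HodgeConjecture.Ring2WeilCoverage.CMTypeSetOddPositions (two_mul_card_eq_card_units)
open Summit.HodgeConjecture.Ring2WeilCoverage.CyclotomicSignaturesG6 (exists_units_sign_eq_thirtySix)
open Summit.HodgeConjecture.Ring2WeilCoverage.CyclotomicUnconditional (norm_realUnits_pos_thirtySix)

variable {K : Type} [Field K] [NumberField K] {ζ : K}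

/-- `𝐞(t) = exp(2πi t/n) ∈ ℂ` (`ZMod.toCircle`). -/
local notation3 (prettyPrint := false) "𝐞 " t:max => ((ZMod.toCircle t : Circle) : ℂ)

section Level36

/-- the residue set `S_Φ` read at level `36`. -/
local notation3 (prettyPrint := false) "SΦ[" Φ "," z "]" =>
  (Finset.univ.filter fun t : ZMod 36 => ∃ σ ∈ (Φ : CMType K).1, σ (z : K) = 𝐞 t)

/-- part 48's twisted sign set `X_π` at level `36` (`n := 36`). -/
local notation3 (prettyPrint := false) "Xtw36 " x:max =>
  (Finset.univ.filter fun t : ZMod 36 => t.val.Coprime 36 ∧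
    ¬ ((36 < (x : ℕ × ℕ × ℕ).1 * ZMod.val t % (2 * 36) ↔ 36 < (x : ℕ × ℕ × ℕ).2.1 * ZMod.val t % (2 * 36)) ↔
      Even (Finset.card (Finset.filter (fun s : ZMod 36 => s.val.Coprime 36 ∧ s.val < t.val) Finset.univ))))

/-- the census's `N_odd` at level `36` (part 5). -/
local notation3 (prettyPrint := false) "Nodd36" =>
  (Finset.univ.filter fun t : ZMod 36 => t.val.Coprime 36 ∧
    Even (Finset.card (Finset.filter (fun s : ZMod 36 => s.val.Coprime 36 ∧ s.val < t.val) Finset.univ)))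

/-- **`N_odd(36) = [1, 7, 13, 19, 25, 31]`** (`decide`). [folklore] -/
theorem nodd_thirtySix_eq : Nodd36 = ({1, 7, 13, 19, 25, 31} : Finset (ZMod 36)) := by
  decide

/-! #### Level `36`, the type `𝔣₀` with `𝔬𝔣₀ = (π)`, `π = ζ^33(1 − ζ^4)(1 − ζ^2)` (`ζ^4` a primitive `9`-th root of unity: `(π) = (1 − ζ^4)`, `(π)^6 = (3)`) -/

/-- the semi-admissibility of `x = (4, 2, 33)` at level `36` (`36 ∤ 4, 2`; `2·33 + 4 + 2 ≡ 0 (mod 72)`). [folklore] -/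
theorem adm_thirtySixA : ¬ 36 ∣ ((4, 2, 33) : ℕ × ℕ × ℕ).1 ∧ ¬ 36 ∣ ((4, 2, 33) : ℕ × ℕ × ℕ).2.1 ∧
    (2 * ((4, 2, 33) : ℕ × ℕ × ℕ).2.2 + ((4, 2, 33) : ℕ × ℕ × ℕ).1 + ((4, 2, 33) : ℕ × ℕ × ℕ).2.1) % (2 * 36) = 0 := by
  decide

/-- **The twisted sign set at level `36` for `π = ζ^33(1 − ζ^4)(1 − ζ^2)`: `X_π = N_odd ∆ A_π = [5, 13, 19, 25, 29, 35]`** (`A_π = [1, 5, 7, 29, 31, 35]`, `|A_π|/2 = 3`;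
`decide`).
research route conditional on HC_CM; not a corollary; Q11.4-sentence-2 already refuted in dim ≥ 3. [folklore] -/
theorem twistSet_thirtySixA : Xtw36 ((4, 2, 33) : ℕ × ℕ × ℕ) = ({5, 13, 19, 25, 29, 35} : Finset (ZMod 36)) := by
  decide

/-- **A type `𝔣₀ ⊆ 𝓞 K⁺` with `𝔬𝔣₀ = (π)`, `π = ζ^33(1 − ζ^4)(1 − ζ^2)`, EXISTS** (part 48 `exists_ideal_map_eq_span_gen`).
research route conditional on HC_CM; not a corollary; Q11.4-sentence-2 already refuted in dim ≥ 3. [cite: Shimura1998, §14.3, p. 103] -/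
theorem exists_type_ideal_thirtySixA [IsCMField K] (hζ : IsPrimitiveRoot ζ 36) :
    ∃ 𝔣₀ : Ideal (𝓞 (maximalRealSubfield K)),
      𝔣₀.map (algebraMap (𝓞 (maximalRealSubfield K)) (𝓞 K)) = Ideal.span {hζ.toInteger ^ 33 * (1 - hζ.toInteger ^ 4) * (1 - hζ.toInteger ^ 2)} :=
  exists_ideal_map_eq_span_gen (x := ((4, 2, 33) : ℕ × ℕ × ℕ)) hζ adm_thirtySixA

omit [NumberField K] in
/-- **`(𝔬𝔣₀)^6 = (3)`** for the type `𝔣₀` with `𝔬𝔣₀ = (π)`, `π = ζ^33(1 − ζ^4)(1 − ζ^2)`: `(π) = (1 − ζ^4)` (the factors `ζ^33`,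
`1 − ζ^2` are units, part 13) and `(1 − ζ^4)^6 = (3)` (part 48c, `ζ^4` a primitive `9`-th root of unity) — so
`N(𝔬𝔣₀) = 3^2`, `N_{K⁺/ℚ}(𝔣₀) = 3^1`: a polarisation of type `𝔣₀` on `ℂ^Φ/Φ(ℤ[ζ_36])` has degree `3`.
research route conditional on HC_CM; not a corollary; Q11.4-sentence-2 already refuted in dim ≥ 3. [cite: Washington1997, Lemma 1.4, Prop. 2.8] -/
theorem map_type_pow_thirtySixA (hζ : IsPrimitiveRoot ζ 36) {𝔣₀ : Ideal (𝓞 (maximalRealSubfield K))}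
    (h𝔣₀ : 𝔣₀.map (algebraMap (𝓞 (maximalRealSubfield K)) (𝓞 K)) = Ideal.span {hζ.toInteger ^ 33 * (1 - hζ.toInteger ^ 4) * (1 - hζ.toInteger ^ 2)}) :
    𝔣₀.map (algebraMap (𝓞 (maximalRealSubfield K)) (𝓞 K)) ^ 6 = Ideal.span {(3 : 𝓞 K)} := by
  have hη : IsPrimitiveRoot (ζ ^ 4) 9 := hζ.pow (by norm_num) (by norm_num)
  have hηint : hη.toInteger = hζ.toInteger ^ 4 := RingOfIntegers.ext (by simp [IsPrimitiveRoot.toInteger])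
  have hu1 : IsUnit (hζ.toInteger ^ 33 : 𝓞 K) := (hζ.toInteger_isPrimitiveRoot.isUnit (by norm_num)).pow 33
  have hu2 : IsUnit (1 - hζ.toInteger ^ 2 : 𝓞 K) := isUnit_one_sub_toInteger_pow hζ (by decide) (by decide +kernel)
  rw [h𝔣₀, Ideal.span_singleton_mul_right_unit hu2, Ideal.span_singleton_mul_left_unit hu1, ← hηint]
  exact span_one_sub_pow_eq_nine hη

open scoped Classical in
/-- **CENSUS ROW `(ℚ(ζ_36), ℚ(√−3))` (a NO row for principal polarisations) — the RAMIFIED TYPE EXISTS: for every CM type `Φ`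
of `ℚ(ζ_36)` balanced for `N_K = [5, 11, 17, 23, 29, 35]` (the Weil signature `(3,3)` on `K = ℚ(√−3)`) and every type `𝔣₀` with
`𝔬𝔣₀ = (π)`, `π = ζ^33(1 − ζ^4)(1 − ζ^2)`, the principal CM torus `ℂ^Φ/Φ(ℤ[ζ_36])` CARRIES a `Φ`-positive divisor `X_ζ′` of type
`(K; Φ; 𝔣₀)`** — `ζ′^ρ = −ζ′`, `Im φ(ζ′) > 0` on `Φ`, `IsOfType 1 ζ′ 𝔣₀` [Sh98 §14.3 Prop. 4: a polarisation whose `φ_X` is the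
`𝔬𝔣₀`-multiplication, of degree `3`].  Proof: part 48 `exists_type_of_even` + THEOREM L (ii) at `36` + the residue count
`|S_Φ ∩ X_π| ≡ |X_π ∖ N_K| + g/2 = 3 + 3 ≡ 0`.
research route conditional on HC_CM; not a corollary; Q11.4-sentence-2 already refuted in dim ≥ 3. [cite: Shimura1998, §14.3 Prop. 4–5, pp. 103–104] -/
theorem exists_type_thirtySixA_sqrt_neg_three [IsCMField K] [IsCyclotomicExtension {36} ℚ K] (hζ : IsPrimitiveRoot ζ 36)
    (Φ : CMType K) (hbal : 2 * (SΦ[Φ, ζ] ∩ ({5, 11, 17, 23, 29, 35} : Finset (ZMod 36))).card = (SΦ[Φ, ζ]).card)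
    {𝔣₀ : Ideal (𝓞 (maximalRealSubfield K))}
    (h𝔣₀ : 𝔣₀.map (algebraMap (𝓞 (maximalRealSubfield K)) (𝓞 K)) = Ideal.span {hζ.toInteger ^ 33 * (1 - hζ.toInteger ^ 4) * (1 - hζ.toInteger ^ 2)}) :
    ∃ ζ' : K, IsCMField.complexConj K ζ' = -ζ' ∧ (∀ φ : Φ.1, 0 < (φ.1 ζ').im) ∧
        CMTypeLattice.IsOfType (1 : (FractionalIdeal (𝓞 K)⁰ K)ˣ) ζ' 𝔣₀ := by
  have hg : Nat.totient 36 = 2 * (5 + 1) := by decide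
  refine exists_type_of_even hζ hg adm_thirtySixA Φ h𝔣₀ (exists_units_sign_eq_thirtySix hζ Φ) ?_
  rw [twistSet_thirtySixA]
  have hS := isCMTypeSet_residueFilter hζ Φ
  have hX : IsCMTypeSet 36 ({5, 13, 19, 25, 29, 35} : Finset (ZMod 36)) := by decide
  have hNK : IsCMTypeSet 36 ({5, 11, 17, 23, 29, 35} : Finset (ZMod 36)) := by decide
  have h1 := card_inter_mod_two_eq hS hX hNK
  have h2 := two_mul_card_eq_card_units hS
  have hU : (Finset.univ.filter fun t : ZMod 36 => t.val.Coprime 36).card = 12 := by decide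
  have h3 : (({5, 13, 19, 25, 29, 35} : Finset (ZMod 36)) \ ({5, 11, 17, 23, 29, 35} : Finset (ZMod 36))).card = 3 := by decide
  rw [Nat.even_iff]
  omega

open scoped Classical in
/-- **CENSUS ROW `(ℚ(ζ_36), ℚ(√−3))`, headline form: there is a type `𝔣₀ ⊆ 𝓞 K⁺` with `(𝔬𝔣₀)^6 = (3)` such that
`ℂ^Φ/Φ(ℤ[ζ_36])` carries a `Φ`-positive divisor of type `(K; Φ; 𝔣₀)`** for every `K`-balanced CM type `Φ`, `K = ℚ(√−3)`
(polarisation degree `3`; the census's NO row gets an explicit NON-principal polarisation).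
research route conditional on HC_CM; not a corollary; Q11.4-sentence-2 already refuted in dim ≥ 3. [cite: Shimura1998, §14.3 Prop. 4–5, pp. 103–104] -/
theorem exists_ramifiedType_thirtySixA_sqrt_neg_three [IsCMField K] [IsCyclotomicExtension {36} ℚ K]
    (hζ : IsPrimitiveRoot ζ 36) (Φ : CMType K) (hbal : 2 * (SΦ[Φ, ζ] ∩ ({5, 11, 17, 23, 29, 35} : Finset (ZMod 36))).card = (SΦ[Φ, ζ]).card) :
    ∃ 𝔣₀ : Ideal (𝓞 (maximalRealSubfield K)),
      𝔣₀.map (algebraMap (𝓞 (maximalRealSubfield K)) (𝓞 K)) ^ 6 = Ideal.span {(3 : 𝓞 K)} ∧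
      ∃ ζ' : K, IsCMField.complexConj K ζ' = -ζ' ∧ (∀ φ : Φ.1, 0 < (φ.1 ζ').im) ∧
        CMTypeLattice.IsOfType (1 : (FractionalIdeal (𝓞 K)⁰ K)ˣ) ζ' 𝔣₀ := by
  obtain ⟨𝔣₀, h𝔣₀⟩ := exists_type_ideal_thirtySixA hζ
  exact ⟨𝔣₀, map_type_pow_thirtySixA hζ h𝔣₀, exists_type_thirtySixA_sqrt_neg_three hζ Φ hbal h𝔣₀⟩

open scoped Classical in
/-- **Row `(ℚ(ζ_36), ℚ(i))` (a YES row for principal polarisations) does NOT carry the ramified type**: for `Φ` balanced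
for `N_K = [7, 11, 19, 23, 31, 35]` (`K = ℚ(i)`) there is NO `Φ`-positive divisor of type `𝔣₀`, `𝔬𝔣₀ = (π)`, `π = ζ^33(1 − ζ^4)(1 − ζ^2)` —
THEOREM L (i) at `36` + the odd count `|S_Φ ∩ X_π| ≡ 4 + 3` (part 48 `not_exists_type_of_norm_pos_of_odd`).
research route conditional on HC_CM; not a corollary; Q11.4-sentence-2 already refuted in dim ≥ 3. [cite: Shimura1998, §14.3 Prop. 5, p. 104] -/
theorem not_exists_type_thirtySixA_sqrt_neg_one [IsCMField K] [IsCyclotomicExtension {36} ℚ K] (hζ : IsPrimitiveRoot ζ 36)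
    (Φ : CMType K) (hbal : 2 * (SΦ[Φ, ζ] ∩ ({7, 11, 19, 23, 31, 35} : Finset (ZMod 36))).card = (SΦ[Φ, ζ]).card)
    {𝔣₀ : Ideal (𝓞 (maximalRealSubfield K))}
    (h𝔣₀ : 𝔣₀.map (algebraMap (𝓞 (maximalRealSubfield K)) (𝓞 K)) = Ideal.span {hζ.toInteger ^ 33 * (1 - hζ.toInteger ^ 4) * (1 - hζ.toInteger ^ 2)}) :
    ¬ ∃ ζ' : K, IsCMField.complexConj K ζ' = -ζ' ∧ (∀ φ : Φ.1, 0 < (φ.1 ζ').im) ∧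
        CMTypeLattice.IsOfType (1 : (FractionalIdeal (𝓞 K)⁰ K)ˣ) ζ' 𝔣₀ := by
  have hg : Nat.totient 36 = 2 * (5 + 1) := by decide
  refine not_exists_type_of_norm_pos_of_odd hζ hg adm_thirtySixA Φ h𝔣₀ (norm_realUnits_pos_thirtySix hζ) ?_
  rw [twistSet_thirtySixA]
  have hS := isCMTypeSet_residueFilter hζ Φ
  have hX : IsCMTypeSet 36 ({5, 13, 19, 25, 29, 35} : Finset (ZMod 36)) := by decide
  have hNK : IsCMTypeSet 36 ({7, 11, 19, 23, 31, 35} : Finset (ZMod 36)) := by decide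
  have h1 := card_inter_mod_two_eq hS hX hNK
  have h2 := two_mul_card_eq_card_units hS
  have hU : (Finset.univ.filter fun t : ZMod 36 => t.val.Coprime 36).card = 12 := by decide
  have h3 : (({5, 13, 19, 25, 29, 35} : Finset (ZMod 36)) \ ({7, 11, 19, 23, 31, 35} : Finset (ZMod 36))).card = 4 := by decide
  rw [Nat.odd_iff]
  omega

open scoped Classical in
/-- **DICHOTOMY AT LEVEL `36`: every one of the `2^6` CM types `Φ` of `ℚ(ζ_36)` makes `ℂ^Φ/Φ(ℤ[ζ_36])` carry EITHER an
`ι`-compatible principal polarisation OR a `Φ`-positive divisor of the ramified type `𝔣₀` (`𝔬𝔣₀ = (π)`, `π = ζ^33(1 − ζ^4)(1 − ζ^2)`),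
NEVER BOTH** — `|N_odd ∖ X_π| = |A_π|/2 = 3` is odd (equivalently `N_{K⁺/ℚ}(π) < 0`), THEOREM L (i)/(ii) at `36`, part 48
`exists_principal_xor_exists_type`.
research route conditional on HC_CM; not a corollary; Q11.4-sentence-2 already refuted in dim ≥ 3. [cite: Shimura1998, §14.3 Prop. 5, p. 104] -/
theorem exists_principal_xor_type_thirtySixA [IsCMField K] [IsCyclotomicExtension {36} ℚ K] (hζ : IsPrimitiveRoot ζ 36)
    (Φ : CMType K) {𝔣₀ : Ideal (𝓞 (maximalRealSubfield K))}
    (h𝔣₀ : 𝔣₀.map (algebraMap (𝓞 (maximalRealSubfield K)) (𝓞 K)) = Ideal.span {hζ.toInteger ^ 33 * (1 - hζ.toInteger ^ 4) * (1 - hζ.toInteger ^ 2)}) :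
    Xor (∃ ζ' : K, IsCMField.complexConj K ζ' = -ζ' ∧ (∀ φ : Φ.1, 0 < (φ.1 ζ').im) ∧
          CMTypeLattice.IsOfType (1 : (FractionalIdeal (𝓞 K)⁰ K)ˣ) ζ' ⊤)
      (∃ ζ' : K, IsCMField.complexConj K ζ' = -ζ' ∧ (∀ φ : Φ.1, 0 < (φ.1 ζ').im) ∧
          CMTypeLattice.IsOfType (1 : (FractionalIdeal (𝓞 K)⁰ K)ˣ) ζ' 𝔣₀) := by
  have hg : Nat.totient 36 = 2 * (5 + 1) := by decide
  refine exists_principal_xor_exists_type hζ hg adm_thirtySixA Φ h𝔣₀ (norm_realUnits_pos_thirtySix hζ)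
    (exists_units_sign_eq_thirtySix hζ Φ) ?_
  rw [twistSet_thirtySixA, nodd_thirtySix_eq]
  have hS := isCMTypeSet_residueFilter hζ Φ
  have hN : IsCMTypeSet 36 ({1, 7, 13, 19, 25, 31} : Finset (ZMod 36)) := by decide
  have hX : IsCMTypeSet 36 ({5, 13, 19, 25, 29, 35} : Finset (ZMod 36)) := by decide
  have h := card_inter_add_card_inter_eq hS hN hX
  have hd : (({1, 7, 13, 19, 25, 31} : Finset (ZMod 36)) \ ({5, 13, 19, 25, 29, 35} : Finset (ZMod 36))).card = 3 := by decide
  omega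

/-! #### Level `36`, the type `𝔣₀` with `𝔬𝔣₀ = (π)`, `π = ζ^31(1 − ζ^9)(1 − ζ^1)` (`ζ^9` a primitive `4`-th root of unity: `(π) = (1 − ζ^9)`, `(π)^2 = (2)`) -/

/-- the semi-admissibility of `x = (9, 1, 31)` at level `36` (`36 ∤ 9, 1`; `2·31 + 9 + 1 ≡ 0 (mod 72)`). [folklore] -/
theorem adm_thirtySixB : ¬ 36 ∣ ((9, 1, 31) : ℕ × ℕ × ℕ).1 ∧ ¬ 36 ∣ ((9, 1, 31) : ℕ × ℕ × ℕ).2.1 ∧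
    (2 * ((9, 1, 31) : ℕ × ℕ × ℕ).2.2 + ((9, 1, 31) : ℕ × ℕ × ℕ).1 + ((9, 1, 31) : ℕ × ℕ × ℕ).2.1) % (2 * 36) = 0 := by
  decide

/-- **The twisted sign set at level `36` for `π = ζ^31(1 − ζ^9)(1 − ζ^1)`: `X_π = N_odd ∆ A_π = [7, 11, 13, 17, 31, 35]`** (`A_π = [1, 11, 17, 19, 25, 35]`, `|A_π|/2 = 3`;
`decide`).
research route conditional on HC_CM; not a corollary; Q11.4-sentence-2 already refuted in dim ≥ 3. [folklore] -/
theorem twistSet_thirtySixB : Xtw36 ((9, 1, 31) : ℕ × ℕ × ℕ) = ({7, 11, 13, 17, 31, 35} : Finset (ZMod 36)) := by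
  decide

/-- **A type `𝔣₀ ⊆ 𝓞 K⁺` with `𝔬𝔣₀ = (π)`, `π = ζ^31(1 − ζ^9)(1 − ζ^1)`, EXISTS** (part 48 `exists_ideal_map_eq_span_gen`).
research route conditional on HC_CM; not a corollary; Q11.4-sentence-2 already refuted in dim ≥ 3. [cite: Shimura1998, §14.3, p. 103] -/
theorem exists_type_ideal_thirtySixB [IsCMField K] (hζ : IsPrimitiveRoot ζ 36) :
    ∃ 𝔣₀ : Ideal (𝓞 (maximalRealSubfield K)),
      𝔣₀.map (algebraMap (𝓞 (maximalRealSubfield K)) (𝓞 K)) = Ideal.span {hζ.toInteger ^ 31 * (1 - hζ.toInteger ^ 9) * (1 - hζ.toInteger ^ 1)} :=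
  exists_ideal_map_eq_span_gen (x := ((9, 1, 31) : ℕ × ℕ × ℕ)) hζ adm_thirtySixB

omit [NumberField K] in
/-- **`(𝔬𝔣₀)^2 = (2)`** for the type `𝔣₀` with `𝔬𝔣₀ = (π)`, `π = ζ^31(1 − ζ^9)(1 − ζ^1)`: `(π) = (1 − ζ^9)` (the factors `ζ^31`,
`1 − ζ^1` are units, part 13) and `(1 − ζ^9)^2 = (2)` (part 48c, `ζ^9` a primitive `4`-th root of unity) — so
`N(𝔬𝔣₀) = 2^6`, `N_{K⁺/ℚ}(𝔣₀) = 2^3`: a polarisation of type `𝔣₀` on `ℂ^Φ/Φ(ℤ[ζ_36])` has degree `8`.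
research route conditional on HC_CM; not a corollary; Q11.4-sentence-2 already refuted in dim ≥ 3. [cite: Washington1997, Lemma 1.4, Prop. 2.8] -/
theorem map_type_pow_thirtySixB (hζ : IsPrimitiveRoot ζ 36) {𝔣₀ : Ideal (𝓞 (maximalRealSubfield K))}
    (h𝔣₀ : 𝔣₀.map (algebraMap (𝓞 (maximalRealSubfield K)) (𝓞 K)) = Ideal.span {hζ.toInteger ^ 31 * (1 - hζ.toInteger ^ 9) * (1 - hζ.toInteger ^ 1)}) :
    𝔣₀.map (algebraMap (𝓞 (maximalRealSubfield K)) (𝓞 K)) ^ 2 = Ideal.span {(2 : 𝓞 K)} := by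
  have hη : IsPrimitiveRoot (ζ ^ 9) 4 := hζ.pow (by norm_num) (by norm_num)
  have hηint : hη.toInteger = hζ.toInteger ^ 9 := RingOfIntegers.ext (by simp [IsPrimitiveRoot.toInteger])
  have hu1 : IsUnit (hζ.toInteger ^ 31 : 𝓞 K) := (hζ.toInteger_isPrimitiveRoot.isUnit (by norm_num)).pow 31
  have hu2 : IsUnit (1 - hζ.toInteger ^ 1 : 𝓞 K) := isUnit_one_sub_toInteger_pow hζ (by decide) (by decide +kernel)
  rw [h𝔣₀, Ideal.span_singleton_mul_right_unit hu2, Ideal.span_singleton_mul_left_unit hu1, ← hηint]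
  exact span_one_sub_pow_eq_four hη

open scoped Classical in
/-- **CENSUS ROW `(ℚ(ζ_36), ℚ(√−3))` (a NO row for principal polarisations) — the RAMIFIED TYPE EXISTS: for every CM type `Φ`
of `ℚ(ζ_36)` balanced for `N_K = [5, 11, 17, 23, 29, 35]` (the Weil signature `(3,3)` on `K = ℚ(√−3)`) and every type `𝔣₀` with
`𝔬𝔣₀ = (π)`, `π = ζ^31(1 − ζ^9)(1 − ζ^1)`, the principal CM torus `ℂ^Φ/Φ(ℤ[ζ_36])` CARRIES a `Φ`-positive divisor `X_ζ′` of type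
`(K; Φ; 𝔣₀)`** — `ζ′^ρ = −ζ′`, `Im φ(ζ′) > 0` on `Φ`, `IsOfType 1 ζ′ 𝔣₀` [Sh98 §14.3 Prop. 4: a polarisation whose `φ_X` is the
`𝔬𝔣₀`-multiplication, of degree `8`].  Proof: part 48 `exists_type_of_even` + THEOREM L (ii) at `36` + the residue count
`|S_Φ ∩ X_π| ≡ |X_π ∖ N_K| + g/2 = 3 + 3 ≡ 0`.
research route conditional on HC_CM; not a corollary; Q11.4-sentence-2 already refuted in dim ≥ 3. [cite: Shimura1998, §14.3 Prop. 4–5, pp. 103–104] -/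
theorem exists_type_thirtySixB_sqrt_neg_three [IsCMField K] [IsCyclotomicExtension {36} ℚ K] (hζ : IsPrimitiveRoot ζ 36)
    (Φ : CMType K) (hbal : 2 * (SΦ[Φ, ζ] ∩ ({5, 11, 17, 23, 29, 35} : Finset (ZMod 36))).card = (SΦ[Φ, ζ]).card)
    {𝔣₀ : Ideal (𝓞 (maximalRealSubfield K))}
    (h𝔣₀ : 𝔣₀.map (algebraMap (𝓞 (maximalRealSubfield K)) (𝓞 K)) = Ideal.span {hζ.toInteger ^ 31 * (1 - hζ.toInteger ^ 9) * (1 - hζ.toInteger ^ 1)}) :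
    ∃ ζ' : K, IsCMField.complexConj K ζ' = -ζ' ∧ (∀ φ : Φ.1, 0 < (φ.1 ζ').im) ∧
        CMTypeLattice.IsOfType (1 : (FractionalIdeal (𝓞 K)⁰ K)ˣ) ζ' 𝔣₀ := by
  have hg : Nat.totient 36 = 2 * (5 + 1) := by decide
  refine exists_type_of_even hζ hg adm_thirtySixB Φ h𝔣₀ (exists_units_sign_eq_thirtySix hζ Φ) ?_
  rw [twistSet_thirtySixB]
  have hS := isCMTypeSet_residueFilter hζ Φ
  have hX : IsCMTypeSet 36 ({7, 11, 13, 17, 31, 35} : Finset (ZMod 36)) := by decide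
  have hNK : IsCMTypeSet 36 ({5, 11, 17, 23, 29, 35} : Finset (ZMod 36)) := by decide
  have h1 := card_inter_mod_two_eq hS hX hNK
  have h2 := two_mul_card_eq_card_units hS
  have hU : (Finset.univ.filter fun t : ZMod 36 => t.val.Coprime 36).card = 12 := by decide
  have h3 : (({7, 11, 13, 17, 31, 35} : Finset (ZMod 36)) \ ({5, 11, 17, 23, 29, 35} : Finset (ZMod 36))).card = 3 := by decide
  rw [Nat.even_iff]
  omega

open scoped Classical in
/-- **CENSUS ROW `(ℚ(ζ_36), ℚ(√−3))`, headline form: there is a type `𝔣₀ ⊆ 𝓞 K⁺` with `(𝔬𝔣₀)^2 = (2)` such that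
`ℂ^Φ/Φ(ℤ[ζ_36])` carries a `Φ`-positive divisor of type `(K; Φ; 𝔣₀)`** for every `K`-balanced CM type `Φ`, `K = ℚ(√−3)`
(polarisation degree `8`; the census's NO row gets an explicit NON-principal polarisation).
research route conditional on HC_CM; not a corollary; Q11.4-sentence-2 already refuted in dim ≥ 3. [cite: Shimura1998, §14.3 Prop. 4–5, pp. 103–104] -/
theorem exists_ramifiedType_thirtySixB_sqrt_neg_three [IsCMField K] [IsCyclotomicExtension {36} ℚ K]
    (hζ : IsPrimitiveRoot ζ 36) (Φ : CMType K) (hbal : 2 * (SΦ[Φ, ζ] ∩ ({5, 11, 17, 23, 29, 35} : Finset (ZMod 36))).card = (SΦ[Φ, ζ]).card) :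
    ∃ 𝔣₀ : Ideal (𝓞 (maximalRealSubfield K)),
      𝔣₀.map (algebraMap (𝓞 (maximalRealSubfield K)) (𝓞 K)) ^ 2 = Ideal.span {(2 : 𝓞 K)} ∧
      ∃ ζ' : K, IsCMField.complexConj K ζ' = -ζ' ∧ (∀ φ : Φ.1, 0 < (φ.1 ζ').im) ∧
        CMTypeLattice.IsOfType (1 : (FractionalIdeal (𝓞 K)⁰ K)ˣ) ζ' 𝔣₀ := by
  obtain ⟨𝔣₀, h𝔣₀⟩ := exists_type_ideal_thirtySixB hζ
  exact ⟨𝔣₀, map_type_pow_thirtySixB hζ h𝔣₀, exists_type_thirtySixB_sqrt_neg_three hζ Φ hbal h𝔣₀⟩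

open scoped Classical in
/-- **Row `(ℚ(ζ_36), ℚ(i))` (a YES row for principal polarisations) does NOT carry the ramified type**: for `Φ` balanced
for `N_K = [7, 11, 19, 23, 31, 35]` (`K = ℚ(i)`) there is NO `Φ`-positive divisor of type `𝔣₀`, `𝔬𝔣₀ = (π)`, `π = ζ^31(1 − ζ^9)(1 − ζ^1)` —
THEOREM L (i) at `36` + the odd count `|S_Φ ∩ X_π| ≡ 2 + 3` (part 48 `not_exists_type_of_norm_pos_of_odd`).
research route conditional on HC_CM; not a corollary; Q11.4-sentence-2 already refuted in dim ≥ 3. [cite: Shimura1998, §14.3 Prop. 5, p. 104] -/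
theorem not_exists_type_thirtySixB_sqrt_neg_one [IsCMField K] [IsCyclotomicExtension {36} ℚ K] (hζ : IsPrimitiveRoot ζ 36)
    (Φ : CMType K) (hbal : 2 * (SΦ[Φ, ζ] ∩ ({7, 11, 19, 23, 31, 35} : Finset (ZMod 36))).card = (SΦ[Φ, ζ]).card)
    {𝔣₀ : Ideal (𝓞 (maximalRealSubfield K))}
    (h𝔣₀ : 𝔣₀.map (algebraMap (𝓞 (maximalRealSubfield K)) (𝓞 K)) = Ideal.span {hζ.toInteger ^ 31 * (1 - hζ.toInteger ^ 9) * (1 - hζ.toInteger ^ 1)}) :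
    ¬ ∃ ζ' : K, IsCMField.complexConj K ζ' = -ζ' ∧ (∀ φ : Φ.1, 0 < (φ.1 ζ').im) ∧
        CMTypeLattice.IsOfType (1 : (FractionalIdeal (𝓞 K)⁰ K)ˣ) ζ' 𝔣₀ := by
  have hg : Nat.totient 36 = 2 * (5 + 1) := by decide
  refine not_exists_type_of_norm_pos_of_odd hζ hg adm_thirtySixB Φ h𝔣₀ (norm_realUnits_pos_thirtySix hζ) ?_
  rw [twistSet_thirtySixB]
  have hS := isCMTypeSet_residueFilter hζ Φ
  have hX : IsCMTypeSet 36 ({7, 11, 13, 17, 31, 35} : Finset (ZMod 36)) := by decide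
  have hNK : IsCMTypeSet 36 ({7, 11, 19, 23, 31, 35} : Finset (ZMod 36)) := by decide
  have h1 := card_inter_mod_two_eq hS hX hNK
  have h2 := two_mul_card_eq_card_units hS
  have hU : (Finset.univ.filter fun t : ZMod 36 => t.val.Coprime 36).card = 12 := by decide
  have h3 : (({7, 11, 13, 17, 31, 35} : Finset (ZMod 36)) \ ({7, 11, 19, 23, 31, 35} : Finset (ZMod 36))).card = 2 := by decide
  rw [Nat.odd_iff]
  omega

open scoped Classical in
/-- **DICHOTOMY AT LEVEL `36`: every one of the `2^6` CM types `Φ` of `ℚ(ζ_36)` makes `ℂ^Φ/Φ(ℤ[ζ_36])` carry EITHER an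
`ι`-compatible principal polarisation OR a `Φ`-positive divisor of the ramified type `𝔣₀` (`𝔬𝔣₀ = (π)`, `π = ζ^31(1 − ζ^9)(1 − ζ^1)`),
NEVER BOTH** — `|N_odd ∖ X_π| = |A_π|/2 = 3` is odd (equivalently `N_{K⁺/ℚ}(π) < 0`), THEOREM L (i)/(ii) at `36`, part 48
`exists_principal_xor_exists_type`.
research route conditional on HC_CM; not a corollary; Q11.4-sentence-2 already refuted in dim ≥ 3. [cite: Shimura1998, §14.3 Prop. 5, p. 104] -/
theorem exists_principal_xor_type_thirtySixB [IsCMField K] [IsCyclotomicExtension {36} ℚ K] (hζ : IsPrimitiveRoot ζ 36)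
    (Φ : CMType K) {𝔣₀ : Ideal (𝓞 (maximalRealSubfield K))}
    (h𝔣₀ : 𝔣₀.map (algebraMap (𝓞 (maximalRealSubfield K)) (𝓞 K)) = Ideal.span {hζ.toInteger ^ 31 * (1 - hζ.toInteger ^ 9) * (1 - hζ.toInteger ^ 1)}) :
    Xor (∃ ζ' : K, IsCMField.complexConj K ζ' = -ζ' ∧ (∀ φ : Φ.1, 0 < (φ.1 ζ').im) ∧
          CMTypeLattice.IsOfType (1 : (FractionalIdeal (𝓞 K)⁰ K)ˣ) ζ' ⊤)
      (∃ ζ' : K, IsCMField.complexConj K ζ' = -ζ' ∧ (∀ φ : Φ.1, 0 < (φ.1 ζ').im) ∧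
          CMTypeLattice.IsOfType (1 : (FractionalIdeal (𝓞 K)⁰ K)ˣ) ζ' 𝔣₀) := by
  have hg : Nat.totient 36 = 2 * (5 + 1) := by decide
  refine exists_principal_xor_exists_type hζ hg adm_thirtySixB Φ h𝔣₀ (norm_realUnits_pos_thirtySix hζ)
    (exists_units_sign_eq_thirtySix hζ Φ) ?_
  rw [twistSet_thirtySixB, nodd_thirtySix_eq]
  have hS := isCMTypeSet_residueFilter hζ Φ
  have hN : IsCMTypeSet 36 ({1, 7, 13, 19, 25, 31} : Finset (ZMod 36)) := by decide
  have hX : IsCMTypeSet 36 ({7, 11, 13, 17, 31, 35} : Finset (ZMod 36)) := by decide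
  have h := card_inter_add_card_inter_eq hS hN hX
  have hd : (({1, 7, 13, 19, 25, 31} : Finset (ZMod 36)) \ ({7, 11, 13, 17, 31, 35} : Finset (ZMod 36))).card = 3 := by decide
  omega

end Level36

end Summit.HodgeConjecture.Ring2WeilCoverage.RamifiedTypesLevel36

end
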